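import Literature.Probability.Percolation.SlabRSWGluingContact
import HarnessLib

/-!
# Newman–Tassion–Wu 2017, §3.2 — the gluing lemmas for slabs: the surgeries in a rectangle

Topic: `Literature/Probability/Percolation`. Fifth file of the port of §3 of Newman–Tassion–Wu,
*Critical percolation and the minimal spanning tree in slabs* (CPAM 70 (2017); arXiv:1512.09107).
Here the geometry is fixed to that of the gluing lemma GL0 (Thm. 3.6) in a rectangle
`S = R = [a,b] × [c,d]` whose target set `B` is the FULL right side `{b} × [c,d]`, with `A, C ⊆ S`
arbitrary planar sets that are far apart (`RectSetup`), and the three local modifications of the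
proof of Thm. 3.7 are CONSTRUCTED for every configuration of NTW's event `𝒳`
(`GlueData.evXn`: `A ⟷^S B`, `C̄ ⟷^S 𝒩(Γ̄, ρ)`, not `C ⟷^S A`):

* `exists_surgery_far` — if the contact point is at sup-distance `> ρ + 2` from `A` and `C`: a
  `GlueData.Surgery` (reroute `Γ` through the cleared box `(z + B_{ρ+2}) ∩ S ∖ {x = b}` and attach
  the `C`-cluster through a port edge; routing by the tree's `exists_route`);
* `exists_directGlue_A` — if the contact point is within `ρ + 2` of `A`: a direct gluing of the
  `C`-cluster to `Ā` (`DirectGlue k S C A`);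
* `exists_directGlue_C` — if it is within `ρ + 2` of `C`: a direct gluing of the `A`-cluster (along
  `Γ`) to `C̄` (`DirectGlue k S A C`);
* `exists_gadget` — the trichotomy, each cleared set inside a box `z + B_{3ρ+2}`.

The probabilistic bookkeeping (Lemma 3.5) that turns these into the linear bound
`P[𝒳] ≤ K(ε, k, ρ) · P[C ⟷^S A]` is the next file.

## Sources

* C. M. Newman, V. Tassion, W. Wu, *Critical percolation and the minimal spanning tree in slabs*,
  Comm. Pure Appl. Math. 70 (2017), arXiv:1512.09107: §3.2, Definition 3.1, Theorems 3.6–3.7 and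
  the proof of Theorem 3.7, steps (1)–(3) (pp. 8–10 of the arXiv text) [NewmanTassionWu2017].

## Design choices

* `B` is a full side: then `Γ` meets the column `x = b` only at its last vertex, the cleared box
  never contains a vertex of `B̄`, and the tree's routing theorem `exists_route` applies in the box
  as is. Target sets that are proper sub-segments of a side need one more surgery variant (trunk
  ending inside `B̄`) and are left to a later file. -- TODO(general form): NTW's Thm 3.6 allows
  any `A, B, C, D ⊆ ∂S` with disjoint projections and rectilinear domains `S̄ = T̄`.
* The separation `dist*(A, C) > 4ρ + 8` guarantees that at most one of `A`, `C` is near any contact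
  and that the cleared boxes of the direct gluings avoid the respective source set.
-/

noncomputable section

namespace Literature.Probability.Percolation

open MeasureTheory LatticeModels SimpleGraph Filter Topology

namespace NTW17

variable {k : ℕ}

/-! ## The rectangle setting -/

/-- A discrete rectangle is finite. [cite: NewmanTassionWu2017, §3 (the rectangles R)] -/
theorem boxR_finite (xL xR rB rT : ℤ) : (boxR xL xR rB rT).Finite := by
  refine ((Set.finite_Icc xL xR).prod (Set.finite_Icc rB rT)).subset ?_
  intro z hz
  rw [mem_boxR_iff] at hz
  exact ⟨⟨hz.1, hz.2.1⟩, ⟨hz.2.2.1, hz.2.2.2⟩⟩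

/-- **The rectangle setting of GL0** (NTW Thm. 3.6 with `B` a full side): `S = [a,b] × [c,d]` with at
least four columns and rows, target `B = {b} × [c,d]` (the right side), and planar sets `A, C ⊆ S`
with `A` off the right side. [cite: NewmanTassionWu2017, §3.2 (Theorem 3.6, the rectangle S and the sets A, B, C)] -/
structure RectSetup where
  /-- left column -/
  a : ℤ
  /-- right column (the side `B`) -/
  b : ℤ
  /-- bottom row -/
  c : ℤ
  /-- top row -/
  d : ℤ
  /-- the set to be reached -/
  A : Set (ℤ × ℤ)
  /-- the set to be glued -/
  C : Set (ℤ × ℤ)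
  hab : a + 3 ≤ b
  hcd : c + 3 ≤ d
  hA : A ⊆ boxR a b c d
  hC : C ⊆ boxR a b c d
  hAB : ∀ z ∈ A, z.1 ≠ b

namespace RectSetup

variable (T : RectSetup)

/-- The rectangle `S`. [cite: NewmanTassionWu2017, §3.2 (Theorem 3.6, S)] -/
def S : Set (ℤ × ℤ) := boxR T.a T.b T.c T.d

/-- The target side `B = {b} × [c,d]`. [cite: NewmanTassionWu2017, §3.2 (Theorem 3.6, B)] -/
def B : Set (ℤ × ℤ) := {z | z ∈ T.S ∧ z.1 = T.b}

/-- The gluing data `(S, S, A, B, C)`. [cite: NewmanTassionWu2017, §3.2 (Theorem 3.6)] -/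
def Q : GlueData := ⟨T.S, T.S, T.A, T.B, T.C, subset_rfl, boxR_finite _ _ _ _, boxR_finite _ _ _ _⟩

/-- The box `(z + B_r) ∩ S`. [cite: NewmanTassionWu2017, §3.2 (proof of Theorem 3.7, the ball B_{r+1}(z) ∩ S)] -/
def Dbox (z : ℤ × ℤ) (r : ℕ) : Set (ℤ × ℤ) :=
  boxR (max T.a (z.1 - r)) (min T.b (z.1 + r)) (max T.c (z.2 - r)) (min T.d (z.2 + r))

/-- The box `(z + B_r) ∩ S ∖ {x = b}` (off the target side).
[cite: NewmanTassionWu2017, §3.2 (proof of Theorem 3.7, the ball B_{r+1}(z) ∩ S)] -/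
def DG (z : ℤ × ℤ) (r : ℕ) : Set (ℤ × ℤ) :=
  boxR (max T.a (z.1 - r)) (min (T.b - 1) (z.1 + r)) (max T.c (z.2 - r)) (min T.d (z.2 + r))

variable {T}

/-- Membership in `S`. [cite: NewmanTassionWu2017, §3.2 (Theorem 3.6, S)] -/
theorem mem_S_iff {z : ℤ × ℤ} : z ∈ T.S ↔ T.a ≤ z.1 ∧ z.1 ≤ T.b ∧ T.c ≤ z.2 ∧ z.2 ≤ T.d :=
  mem_boxR_iff z

/-- Membership in `Dbox`. [cite: NewmanTassionWu2017, §3.2 (proof of Theorem 3.7)] -/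
theorem mem_Dbox_iff {z w : ℤ × ℤ} {r : ℕ} : w ∈ T.Dbox z r ↔ w ∈ T.S ∧ w ∈ sqBox z r := by
  rw [Dbox, mem_boxR_iff, mem_S_iff, mem_sqBox_iff']
  simp only [max_le_iff, le_min_iff]
  omega

/-- Membership in `DG`. [cite: NewmanTassionWu2017, §3.2 (proof of Theorem 3.7)] -/
theorem mem_DG_iff {z w : ℤ × ℤ} {r : ℕ} : w ∈ T.DG z r ↔ w ∈ T.S ∧ w ∈ sqBox z r ∧ w.1 ≠ T.b := by
  rw [DG, mem_boxR_iff, mem_S_iff, mem_sqBox_iff']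
  simp only [max_le_iff, le_min_iff]
  omega

/-- `Dbox ⊆ S`. [cite: NewmanTassionWu2017, §3.2 (proof of Theorem 3.7)] -/
theorem Dbox_subset_S (z : ℤ × ℤ) (r : ℕ) : T.Dbox z r ⊆ T.S := fun _ h => (mem_Dbox_iff.1 h).1

/-- `Dbox ⊆ z + B_r`. [cite: NewmanTassionWu2017, §3.2 (proof of Theorem 3.7)] -/
theorem Dbox_subset_sqBox (z : ℤ × ℤ) (r : ℕ) : T.Dbox z r ⊆ sqBox z r := fun _ h => (mem_Dbox_iff.1 h).2

/-- `DG ⊆ S`. [cite: NewmanTassionWu2017, §3.2 (proof of Theorem 3.7)] -/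
theorem DG_subset_S (z : ℤ × ℤ) (r : ℕ) : T.DG z r ⊆ T.S := fun _ h => (mem_DG_iff.1 h).1

/-- `DG ⊆ z + B_r`. [cite: NewmanTassionWu2017, §3.2 (proof of Theorem 3.7)] -/
theorem DG_subset_sqBox (z : ℤ × ℤ) (r : ℕ) : T.DG z r ⊆ sqBox z r := fun _ h => (mem_DG_iff.1 h).2.1

/-- `DG` avoids the target side. [cite: NewmanTassionWu2017, §3.2 (proof of Theorem 3.7)] -/
theorem DG_disjoint_B {z w : ℤ × ℤ} {r : ℕ} (h : w ∈ T.DG z r) : w ∉ T.B := fun hB =>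
  (mem_DG_iff.1 h).2.2 hB.2

/-- The events of `T.Q` unfold to the rectangle data. [cite: NewmanTassionWu2017, §3.2 (Theorem 3.6)] -/
theorem Q_S : T.Q.S = T.S := rfl

/-- `T.Q.R = T.S`. [cite: NewmanTassionWu2017, §3.2 (Theorem 3.6)] -/
theorem Q_R : T.Q.R = T.S := rfl

/-- `T.Q.A = T.A`. [cite: NewmanTassionWu2017, §3.2 (Theorem 3.6)] -/
theorem Q_A : T.Q.A = T.A := rfl

/-- `T.Q.B = T.B`. [cite: NewmanTassionWu2017, §3.2 (Theorem 3.6)] -/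
theorem Q_B : T.Q.B = T.B := rfl

/-- `T.Q.C = T.C`. [cite: NewmanTassionWu2017, §3.2 (Theorem 3.6)] -/
theorem Q_C : T.Q.C = T.C := rfl

end RectSetup

/-- Symmetry of `X ⟷^R Y`. [cite: NewmanTassionWu2017, §3.2 (the event A ↔^S B)] -/
theorem slabConn_comm {R X Y : Set (ℤ × ℤ)} {ω : BondConfig (slab 3 k)} (h : ω ∈ slabConn k R X Y) :
    ω ∈ slabConn k R Y X := by
  obtain ⟨x, hx, y, hy, hxy⟩ := h
  exact ⟨y, hy, x, hx, openConnIn_reverse hxy⟩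

/-! ## Type Γ: rerouting the minimal path (contact far from `A` and `C`) -/

section TypeGamma

variable {T : RectSetup} {ω : BondConfig (slab 3 k)} {ρ : ℕ}

/-- **Two vertices of `Γ` over the cleared box.** If the contact point `z` is within `ρ` of `Γ̄`
and no cell of `A` is within `ρ + 2` of `z`, then `Γ` has two distinct vertices over
`DG z (ρ+2)`. [cite: NewmanTassionWu2017, §3.2 (proof of Theorem 3.7, step (1), u′ ≠ v′)] -/
theorem exists_two_γ (hω : ω ⊆ (slabGraph 3 k).edgeSet) (hA : ω ∈ T.Q.evAB k) {z : ℤ × ℤ}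
    (hnear : Near k (T.Q.γ k ω) ρ z) (hnA : ∀ a' ∈ T.A, a' ∉ sqBox z (ρ + 2)) :
    ∃ x ∈ T.Q.γ k ω, ∃ y ∈ T.Q.γ k ω, x ≠ y ∧ planar k x ∈ T.DG z (ρ + 2) ∧
      planar k y ∈ T.DG z (ρ + 2) := by
  obtain ⟨hγO, -⟩ := T.Q.γ_spec hA
  set γ := T.Q.γ k ω with hγdef
  have hγch := isChain_adj_of_isChain_open hω hγO.chain
  obtain ⟨g₀, hg₀, hz⟩ := hnear
  have hg₀z : planar k g₀ ∈ sqBox z ρ := GlueGeom.mem_sqBox_comm hz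
  -- criteria
  have crit : ∀ v ∈ γ, planar k v ∈ sqBox z (ρ + 2) → v ≠ γ.getLast hγO.ne_nil →
      planar k v ∈ T.DG z (ρ + 2) := by
    intro v hv hvz hvl
    rw [RectSetup.mem_DG_iff]
    refine ⟨hγO.subset v hv, hvz, fun hb => hvl (eq_getLast_of_mem_B hA hv ⟨hγO.subset v hv, hb⟩)⟩
  have critA : ∀ v ∈ γ, planar k v ∈ sqBox z (ρ + 2) → v ≠ γ.head hγO.ne_nil := by
    intro v hv hvz hvh
    have : planar k v ∈ T.A := by rw [hvh]; exact head_mem_A hA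
    exact hnA _ this hvz
  obtain ⟨p, s, hps⟩ := List.append_of_mem hg₀
  have hnd := hγO.nodup
  by_cases hlast : g₀ = γ.getLast hγO.ne_nil
  · -- `g₀` is the last vertex: use the two vertices before it
    have hs : s = [] := by
      by_contra hs
      have h1 : γ.getLast hγO.ne_nil = s.getLast hs := by
        have e1 : γ.getLast hγO.ne_nil = (p ++ g₀ :: s).getLast (by simp) := List.getLast_congr _ _ hps
        rw [e1, List.getLast_append_of_ne_nil _ (List.cons_ne_nil _ _), List.getLast_cons hs]
      rw [hps, List.nodup_append] at hnd
      have hg₀s : g₀ ∈ s := by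
        have e := hlast.trans h1
        rw [e]
        exact List.getLast_mem hs
      exact (List.nodup_cons.1 hnd.2.1).1 hg₀s
    subst hs
    have hp : p ≠ [] := by
      rintro rfl
      refine critA g₀ hg₀ (sqBox_mono _ (by omega) hg₀z) ?_
      exact ((List.head_eq_iff_head?_eq_some _).2 (by rw [hps]; rfl)).symm
    set v₁ := p.getLast hp with hv₁
    have hv₁γ : v₁ ∈ γ := by rw [hps]; exact List.mem_append_left _ (List.getLast_mem hp)
    have hadj₁ : (slabGraph 3 k).Adj v₁ g₀ := by
      rw [hps] at hγch
      exact List.IsChain.rel_getLast_head_of_append hγch hp (by simp)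
    have hv₁z : planar k v₁ ∈ sqBox z (ρ + 1) :=
      mem_sqBox_add hg₀z (planar_mem_sqBox_one_of_adj hadj₁.symm)
    have hv₁ne : v₁ ≠ g₀ := by
      rw [hps, List.nodup_append] at hnd
      exact fun h => hnd.2.2 v₁ (List.getLast_mem hp) g₀ (by simp) h
    obtain ⟨p', hp'⟩ : ∃ p', p = p' ++ [v₁] := ⟨p.dropLast, (List.dropLast_concat_getLast hp).symm⟩
    have hp'ne : p' ≠ [] := by
      rintro rfl
      simp only [List.nil_append] at hp'
      refine critA v₁ hv₁γ (sqBox_mono _ (by omega) hv₁z) ?_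
      exact ((List.head_eq_iff_head?_eq_some _).2 (by rw [hps, hp']; rfl)).symm
    set v₂ := p'.getLast hp'ne with hv₂
    have hv₂p : v₂ ∈ p := by rw [hp']; exact List.mem_append_left _ (List.getLast_mem hp'ne)
    have hv₂γ : v₂ ∈ γ := by rw [hps]; exact List.mem_append_left _ hv₂p
    have hadj₂ : (slabGraph 3 k).Adj v₂ v₁ := by
      rw [hps, hp'] at hγch
      have h1 := (List.isChain_append.1 hγch).1
      exact List.IsChain.rel_getLast_head_of_append h1 hp'ne (by simp)
    have hv₂z : planar k v₂ ∈ sqBox z (ρ + 2) := by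
      have := mem_sqBox_add hv₁z (planar_mem_sqBox_one_of_adj hadj₂.symm)
      simpa [add_assoc] using this
    have hv₂ne : v₂ ≠ v₁ := by
      rw [hps, hp', List.nodup_append] at hnd
      have := (List.nodup_append.1 hnd.1).2.2
      exact fun h => this v₂ (List.getLast_mem hp'ne) v₁ (by simp) h
    refine ⟨v₁, hv₁γ, v₂, hv₂γ, hv₂ne.symm, crit v₁ hv₁γ (sqBox_mono _ (by omega) hv₁z)
      (fun h => hv₁ne (h.trans hlast.symm)), crit v₂ hv₂γ hv₂z (fun h => ?_)⟩
    rw [hps, List.nodup_append] at hnd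
    exact hnd.2.2 v₂ hv₂p g₀ (by simp) (h.trans hlast.symm)
  · -- `g₀` is not the last vertex: use `g₀` and its predecessor
    have hp : p ≠ [] := by
      rintro rfl
      refine critA g₀ hg₀ (sqBox_mono _ (by omega) hg₀z) ?_
      exact ((List.head_eq_iff_head?_eq_some _).2 (by rw [hps]; rfl)).symm
    set v₁ := p.getLast hp with hv₁
    have hv₁γ : v₁ ∈ γ := by rw [hps]; exact List.mem_append_left _ (List.getLast_mem hp)
    have hadj₁ : (slabGraph 3 k).Adj v₁ g₀ := by
      rw [hps] at hγch
      exact List.IsChain.rel_getLast_head_of_append hγch hp (by simp)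
    have hv₁z : planar k v₁ ∈ sqBox z (ρ + 1) :=
      mem_sqBox_add hg₀z (planar_mem_sqBox_one_of_adj hadj₁.symm)
    have hv₁ne : v₁ ≠ g₀ := by
      rw [hps, List.nodup_append] at hnd
      exact fun h => hnd.2.2 v₁ (List.getLast_mem hp) g₀ (by simp) h
    have hv₁last : v₁ ≠ γ.getLast hγO.ne_nil := by
      intro h
      -- the last vertex lies in `g₀ :: s`, not in `p`
      have hmem : γ.getLast hγO.ne_nil ∈ g₀ :: s := by
        rw [List.getLast_congr _ (by simp) hps, List.getLast_append_of_ne_nil _ (by simp)]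
        exact List.getLast_mem _
      rw [hps, List.nodup_append] at hnd
      exact hnd.2.2 v₁ (List.getLast_mem hp) _ hmem h
    exact ⟨g₀, hg₀, v₁, hv₁γ, hv₁ne.symm, crit g₀ hg₀ (sqBox_mono _ (by omega) hg₀z) hlast,
      crit v₁ hv₁γ (sqBox_mono _ (by omega) hv₁z) hv₁last⟩

/-- **The surgery when the contact is far from `A` and `C`** (NTW, proof of Thm. 3.7, steps
(1)–(3), general position): given a normalised contact (`c₀ ∈ C̄`, an `ω`-open self-avoiding
path `l ++ [q]` from `c₀` inside `S̄` whose last vertex is within `ρ` of `Γ̄` and whose other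
vertices are not) with no cell of `A` or `C` within `ρ + 2` of `planar q`, there is a surgery
whose cleared set lies in `planar q + B_{ρ+2}`. [cite: NewmanTassionWu2017, §3.2 (proof of Theorem 3.7, steps (1)–(3))] -/
theorem exists_surgery_far (hk : 1 ≤ k) (hρ : 2 ≤ ρ) (hω : ω ⊆ (slabGraph 3 k).edgeSet)
    (hX : ω ∈ T.Q.evX k) {c₀ q : slab 3 k} {l : List (slab 3 k)} (hc₀ : c₀ ∈ slabLift k T.C)
    (hch : (l ++ [q]).IsChain (fun a b => s(a, b) ∈ ω ∧ a ≠ b)) (hnd : (l ++ [q]).Nodup)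
    (hsub : ∀ x ∈ l ++ [q], x ∈ slabLift k T.S) (hhead : (l ++ [q]).head (by simp) = c₀)
    (hnear : Near k (T.Q.γ k ω) ρ (planar k q)) (hfar : ∀ x ∈ l, ¬Near k (T.Q.γ k ω) ρ (planar k x))
    (hnA : ∀ a' ∈ T.A, a' ∉ sqBox (planar k q) (ρ + 2))
    (hnC : ∀ c' ∈ T.C, c' ∉ sqBox (planar k q) (ρ + 2)) :
    ∃ sx : T.Q.Surgery k ω, sx.D ⊆ sqBox (planar k q) (ρ + 2) := by
  have hA : ω ∈ T.Q.evAB k := hX.1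
  obtain ⟨hγO, -⟩ := T.Q.γ_spec hA
  set z := planar k q with hzdef
  set D := T.DG z (ρ + 2) with hDdef
  have hzS : z ∈ T.S := hsub q (by simp)
  -- `l ≠ []`: otherwise `q = c₀ ∈ C̄` is a `C`-cell at the contact point
  have hl : l ≠ [] := by
    rintro rfl
    simp only [List.nil_append, List.head_cons] at hhead
    have : planar k q ∈ T.C := by rw [hhead]; exact hc₀
    exact hnC _ this (mem_sqBox_self _ _)
  have hqn : ¬Near k (T.Q.γ k ω) (ρ - 1) z := not_near_pred_of_contact hω hch hfar hl (by omega)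
  -- `c₀` is off `D̄`
  have hc₀D : planar k c₀ ∉ D := fun h =>
    hnC _ hc₀ (RectSetup.DG_subset_sqBox _ _ h)
  have hDA : ∀ w ∈ D, w ∉ T.Q.A := fun w hw hwA => hnA w hwA (RectSetup.DG_subset_sqBox _ _ hw)
  have hDB : ∀ w ∈ D, w ∉ T.Q.B := fun w hw => RectSetup.DG_disjoint_B hw
  have htwo := exists_two_γ hω hA hnear hnA
  -- the port
  obtain ⟨w', q₁, hadj, hw'D, hq₁D, hσ, hw'far⟩ : ∃ w' q₁ : slab 3 k, (slabGraph 3 k).Adj w' q₁ ∧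
      planar k w' ∈ D ∧ planar k q₁ ∉ D ∧ ω ∈ openConnIn (slabLift k (T.S \ D)) q₁ c₀ ∧
      ¬Near k (T.Q.γ k ω) 0 (planar k w') := by
    by_cases hin : ∃ x ∈ l ++ [q], planar k x ∈ D
    · -- the path enters `D̄`
      have hheadD : planar k ((l ++ [q]).head (by simp)) ∉ D := by rw [hhead]; exact hc₀D
      obtain ⟨m, w', rest, hm, hLeq, hmD, hw'D, hedge, hne, hmhead, hconn, -⟩ :=
        exists_entry (R := T.S) hch hnd hsub (by simp) hheadD hin
      rw [hhead] at hconn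
      have hadj : (slabGraph 3 k).Adj (m.getLast hm) w' := (SimpleGraph.mem_edgeSet _).1 (hω hedge)
      refine ⟨w', m.getLast hm, hadj.symm, hw'D, hmD _ (List.getLast_mem hm), openConnIn_reverse hconn, ?_⟩
      -- `w'` is a vertex of `l ++ [q]`: not within `ρ - 1 ≥ 0`
      have hw'mem : w' ∈ l ++ [q] := by rw [hLeq]; simp
      rcases List.mem_append.1 hw'mem with h | h
      · exact fun hn => hfar w' h (hn.mono (by omega))
      · rw [List.mem_singleton] at h
        rw [h]; exact fun hn => hqn (hn.mono (by omega))
    · -- the path stays off `D̄`: then `q` lies over the column `x = b`, next to `D`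
      push Not at hin
      have hzb : z.1 = T.b := by
        by_contra hzb
        exact hin q (by simp) (RectSetup.mem_DG_iff.2 ⟨hzS, mem_sqBox_self _ _, hzb⟩)
      set wp : ℤ × ℤ := (T.b - 1, z.2) with hwp
      have hwpD : wp ∈ D := by
        rw [RectSetup.mem_DG_iff, RectSetup.mem_S_iff, mem_sqBox_iff']
        rw [RectSetup.mem_S_iff] at hzS
        have := T.hab
        refine ⟨⟨by simp [hwp]; omega, by simp [hwp], by simp [hwp]; omega, by simp [hwp]; omega⟩,
          ⟨by simp [hwp]; omega, by simp [hwp]; omega, by simp [hwp]; omega, by simp [hwp]; omega⟩,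
          by simp [hwp]⟩
      have hpadj : planarAdj z wp := by
        simp only [planarAdj, hwp, Prod.ext_iff, Prod.fst_add, Prod.snd_add]
        left; right; constructor <;> simp [hzb]
      set w' : slab 3 k := vtx k wp (ht q) with hw'def
      have hq : q = vtx k z (ht q) := (vtx_planar_ht q).symm
      have hadj : (slabGraph 3 k).Adj w' q := by
        rw [hq, hw'def]
        exact vtx_adj_vtx_planar (planarAdj_symm hpadj) _
      have hw'p : planar k w' = wp := planar_vtx _ _
      refine ⟨w', q, hadj, by rw [hw'p]; exact hwpD, hin q (by simp), ?_, ?_⟩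
      · -- the whole path is an `ω`-open connection off `D̄`
        obtain ⟨l0, l', hl0⟩ := List.exists_cons_of_ne_nil (show l ++ [q] ≠ [] by simp)
        have hsub' : ∀ x ∈ l0 :: l', x ∈ slabLift k (T.S \ D) := by
          intro x hx; rw [← hl0] at hx
          exact ⟨hsub x hx, hin x hx⟩
        have h1 := openConnIn_of_isChain l0 l' (by rw [← hl0]; exact hch) hsub'
        have hh : l0 = c₀ := by
          have := (List.head_eq_iff_head?_eq_some _).1 hhead
          rw [hl0] at this; simpa using this
        have hl : (l0 :: l').getLast (List.cons_ne_nil _ _) = q := by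
          have e := List.getLast_congr (List.cons_ne_nil l0 l') (by simp : l ++ [q] ≠ []) hl0.symm
          rw [e]; simp
        rw [hl] at h1; rw [hh] at h1
        exact openConnIn_reverse h1
      · rw [hw'p]
        have : ¬Near k (T.Q.γ k ω) (ρ - 2 + 1) z := by rwa [show ρ - 2 + 1 = ρ - 1 by omega]
        exact fun hn => (not_near_of_step this (mem_sqBox_one_of_planarAdj hpadj)) (hn.mono (by omega))
  -- routing in the box `D`
  have hroute : ∀ E₁ E₂ : slab 3 k, E₁ ∈ T.Q.γ k ω → E₂ ∈ T.Q.γ k ω → E₁ ≠ E₂ →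
      planar k E₁ ∈ D → planar k E₂ ∈ D → ∃ L Br c, RouteSpec k D D E₁ E₂ w' L Br c := by
    intro E₁ E₂ hE₁ hE₂ hne hE₁D hE₂D
    have hzS' := hzS
    rw [RectSetup.mem_S_iff] at hzS'
    have hab := T.hab; have hcd := T.hcd
    exact exists_route (xL := max T.a (z.1 - (ρ + 2 : ℕ))) (xR' := min (T.b - 1) (z.1 + (ρ + 2 : ℕ)))
      (xR := min (T.b - 1) (z.1 + (ρ + 2 : ℕ))) (rB := max T.c (z.2 - (ρ + 2 : ℕ)))
      (rP := min T.d (z.2 + (ρ + 2 : ℕ))) (rT := min T.d (z.2 + (ρ + 2 : ℕ)))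
      hk (by push_cast; omega) le_rfl (by push_cast; omega) le_rfl hE₁D hE₂D hw'D hne
      (ne_planar_of_not_near hw'far hE₁).symm (ne_planar_of_not_near hw'far hE₂).symm
  obtain ⟨sx, hsx⟩ := exists_surgery_of_route (Q := T.Q) hX (D := D) (Dt := D)
    (RectSetup.DG_subset_S _ _) hDA hDB subset_rfl (RectSetup.DG_subset_S _ _) htwo hadj hq₁D hc₀
    hσ hroute
  exact ⟨sx, hsx ▸ RectSetup.DG_subset_sqBox _ _⟩

end TypeGamma

/-! ## Types A and C: direct gluings near `A` and near `C` -/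

section TypeAC

variable {T : RectSetup} {ω : BondConfig (slab 3 k)} {ρ : ℕ}

/-- **Direct gluing near `A`**: if a cell of `A` is within `ρ + 2` of the contact point, the
`C`-cluster is glued to `Ā` inside the box `planar q + B_{ρ+2}`.
[cite: NewmanTassionWu2017, §3.2 (proof of Theorem 3.7, steps (2)–(3), near A)] -/
theorem exists_directGlue_A (hω : ω ⊆ (slabGraph 3 k).edgeSet) (hX : ω ∈ T.Q.evX k)
    (hsep : ∀ a' ∈ T.A, ∀ c' ∈ T.C, c' ∉ sqBox a' (4 * ρ + 8))
    {c₀ q : slab 3 k} {l : List (slab 3 k)} (hc₀ : c₀ ∈ slabLift k T.C)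
    (hch : (l ++ [q]).IsChain (fun a b => s(a, b) ∈ ω ∧ a ≠ b)) (hnd : (l ++ [q]).Nodup)
    (hsub : ∀ x ∈ l ++ [q], x ∈ slabLift k T.S) (hhead : (l ++ [q]).head (by simp) = c₀)
    (hA' : ∃ a' ∈ T.A, a' ∈ sqBox (planar k q) (ρ + 2)) :
    ∃ dg : DirectGlue k T.S T.C T.A ω, dg.D ⊆ sqBox (planar k q) (ρ + 2) := by
  set z := planar k q with hzdef
  set D := T.Dbox z (ρ + 2) with hDdef
  obtain ⟨a', ha', ha'z⟩ := hA'
  have hzS : z ∈ T.S := hsub q (by simp)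
  have hDC : ∀ w ∈ D, w ∉ T.C := by
    intro w hw hwC
    have hwz := RectSetup.Dbox_subset_sqBox _ _ hw
    have : w ∈ sqBox a' ((ρ + 2) + (ρ + 2)) := mem_sqBox_add (GlueGeom.mem_sqBox_comm ha'z) hwz
    exact hsep a' ha' w hwC (sqBox_mono _ (by omega) this)
  have hc₀D : planar k c₀ ∉ D := fun h => hDC _ h hc₀
  have hheadD : planar k ((l ++ [q]).head (by simp)) ∉ D := by rw [hhead]; exact hc₀D
  have hqD : planar k q ∈ D := RectSetup.mem_Dbox_iff.2 ⟨hzS, mem_sqBox_self _ _⟩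
  obtain ⟨m, w', rest, hm, hLeq, hmD, hw'D, hedge, hne, hmhead, hconn, -⟩ :=
    exists_entry (R := T.S) hch hnd hsub (by simp) hheadD ⟨q, by simp, hqD⟩
  rw [hhead] at hconn
  have hadj : (slabGraph 3 k).Adj (m.getLast hm) w' := (SimpleGraph.mem_edgeSet _).1 (hω hedge)
  -- `w'` is `ω`-joined to `c₀`, hence not over `A`
  have hw'A : planar k w' ∉ T.A := by
    intro hw'A
    obtain ⟨l0, l', hl0⟩ := List.exists_cons_of_ne_nil (show l ++ [q] ≠ [] by simp)
    have hsub' : ∀ x ∈ l0 :: l', x ∈ slabLift k T.S := fun x hx => hsub x (by rw [hl0]; exact hx)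
    have h1 := openConnIn_head_of_mem l0 l' (by rw [← hl0]; exact hch) hsub' w'
      (by rw [← hl0, hLeq]; simp)
    have hh : l0 = c₀ := by
      have := (List.head_eq_iff_head?_eq_some _).1 hhead
      rw [hl0] at this; simpa using this
    rw [hh] at h1
    exact T.Q.not_joined_of_evX hX (a := w') (c := c₀) hw'A hc₀ (openConnIn_reverse h1)
  have ha'D : a' ∈ D := RectSetup.mem_Dbox_iff.2 ⟨T.hA ha', ha'z⟩
  obtain ⟨dg, hdg⟩ := exists_directGlue (R := T.S) (Src := T.C) (Tg := T.A)
    (RectSetup.Dbox_subset_S _ _) hDC hc₀ (hmD _ (List.getLast_mem hm)) hconn hadj hw'D hw'A ha'D ha'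
  exact ⟨dg, hdg ▸ RectSetup.Dbox_subset_sqBox _ _⟩

/-- **Direct gluing near `C`**: if a cell of `C` is within `ρ + 2` of the contact point (itself
within `ρ` of a vertex `g₀` of `Γ`), the `A`-cluster is glued along `Γ` to `C̄` inside the box
`planar g₀ + B_{2ρ+2} ⊆ planar q + B_{3ρ+2}`.
[cite: NewmanTassionWu2017, §3.2 (proof of Theorem 3.7, steps (2)–(3), near C)] -/
theorem exists_directGlue_C (hω : ω ⊆ (slabGraph 3 k).edgeSet) (hX : ω ∈ T.Q.evX k)
    (hsep : ∀ a' ∈ T.A, ∀ c' ∈ T.C, c' ∉ sqBox a' (4 * ρ + 8)) {q : slab 3 k}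
    (hnear : Near k (T.Q.γ k ω) ρ (planar k q)) (hC' : ∃ c' ∈ T.C, c' ∈ sqBox (planar k q) (ρ + 2)) :
    ∃ dg : DirectGlue k T.S T.A T.C ω, dg.D ⊆ sqBox (planar k q) (3 * ρ + 2) := by
  have hA : ω ∈ T.Q.evAB k := hX.1
  obtain ⟨hγO, -⟩ := T.Q.γ_spec hA
  set γ := T.Q.γ k ω with hγdef
  obtain ⟨g₀, hg₀, hz⟩ := hnear
  obtain ⟨c', hc', hc'z⟩ := hC'
  set g := planar k g₀ with hgdef
  set D := T.Dbox g (2 * ρ + 2) with hDdef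
  have hg₀S : g ∈ T.S := hγO.subset g₀ hg₀
  have hc'D : c' ∈ D := by
    refine RectSetup.mem_Dbox_iff.2 ⟨T.hC hc', ?_⟩
    have := mem_sqBox_add hz hc'z
    simpa [two_mul, add_assoc, add_comm, add_left_comm] using this
  have hDA : ∀ w ∈ D, w ∉ T.A := by
    intro w hw hwA
    have hwg := RectSetup.Dbox_subset_sqBox _ _ hw
    have h1 : c' ∈ sqBox g (2 * ρ + 2) := (RectSetup.mem_Dbox_iff.1 hc'D).2
    have h2 : c' ∈ sqBox w ((2 * ρ + 2) + (2 * ρ + 2)) := mem_sqBox_add (GlueGeom.mem_sqBox_comm hwg) h1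
    exact hsep w hwA c' hc' (sqBox_mono _ (by omega) h2)
  have hheadD : planar k (γ.head hγO.ne_nil) ∉ D := fun h => hDA _ h (head_mem_A hA)
  have hg₀D : planar k g₀ ∈ D := RectSetup.mem_Dbox_iff.2 ⟨hg₀S, mem_sqBox_self _ _⟩
  obtain ⟨m, w', rest, hm, hγeq, hmD, hw'D, hedge, hne, hmhead, hconn, -⟩ :=
    exists_entry (R := T.S) hγO.chain hγO.nodup hγO.subset hγO.ne_nil hheadD ⟨g₀, hg₀, hg₀D⟩
  have hadj : (slabGraph 3 k).Adj (m.getLast hm) w' := (SimpleGraph.mem_edgeSet _).1 (hω hedge)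
  have hw'γ : w' ∈ γ := by rw [hγeq]; simp
  have hw'C : planar k w' ∉ T.C := fun h => not_mem_C_of_mem_γ hX hw'γ h
  obtain ⟨dg, hdg⟩ := exists_directGlue (R := T.S) (Src := T.A) (Tg := T.C)
    (RectSetup.Dbox_subset_S _ _) hDA (head_mem_A hA) (hmD _ (List.getLast_mem hm)) hconn hadj
    hw'D hw'C hc'D hc'
  refine ⟨dg, hdg ▸ fun w hw => ?_⟩
  have h1 := RectSetup.Dbox_subset_sqBox _ _ hw
  have h2 : w ∈ sqBox (planar k q) (ρ + (2 * ρ + 2)) := mem_sqBox_add (GlueGeom.mem_sqBox_comm hz) h1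
  exact sqBox_mono _ (by omega) h2

end TypeAC

/-! ## The trichotomy -/

section Gadget

variable {T : RectSetup} {ω : BondConfig (slab 3 k)} {ρ : ℕ}

/-- **Every configuration of `𝒳` admits one of the three local modifications**, with cleared set
inside a box of radius `3ρ + 2`: a rerouting surgery of `Γ` (contact far from `A` and `C`), a direct
gluing of the `C`-cluster to `Ā` (contact near `A`), or a direct gluing of the `A`-cluster to `C̄`
(contact near `C`). [cite: NewmanTassionWu2017, §3.2 (proof of Theorem 3.7, "we can construct a map Φ : 𝒳 → 𝔓(𝒳′)")] -/
theorem exists_gadget (hk : 1 ≤ k) (hρ : 2 ≤ ρ)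
    (hsep : ∀ a' ∈ T.A, ∀ c' ∈ T.C, c' ∉ sqBox a' (4 * ρ + 8))
    (hω : ω ⊆ (slabGraph 3 k).edgeSet) (hX : ω ∈ T.Q.evXn k ρ) :
    (∃ sx : T.Q.Surgery k ω, ∃ z : ℤ × ℤ, sx.D ⊆ sqBox z (3 * ρ + 2)) ∨
      (∃ dg : DirectGlue k T.S T.C T.A ω, ∃ z : ℤ × ℤ, dg.D ⊆ sqBox z (3 * ρ + 2)) ∨
      (∃ dg : DirectGlue k T.S T.A T.C ω, ∃ z : ℤ × ℤ, dg.D ⊆ sqBox z (3 * ρ + 2)) := by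
  obtain ⟨c₀, q, l, hc₀, hch, hnd, hsub, hhead, hnear, hfar⟩ := exists_contact hX
  have hX' : ω ∈ T.Q.evX k := hX.1
  by_cases hA' : ∃ a' ∈ T.A, a' ∈ sqBox (planar k q) (ρ + 2)
  · obtain ⟨dg, hdg⟩ := exists_directGlue_A hω hX' hsep hc₀ hch hnd hsub hhead hA'
    exact Or.inr (Or.inl ⟨dg, planar k q, hdg.trans (sqBox_mono _ (by omega))⟩)
  by_cases hC' : ∃ c' ∈ T.C, c' ∈ sqBox (planar k q) (ρ + 2)
  · obtain ⟨dg, hdg⟩ := exists_directGlue_C hω hX' hsep hnear hC'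
    exact Or.inr (Or.inr ⟨dg, planar k q, hdg⟩)
  push Not at hA' hC'
  obtain ⟨sx, hsx⟩ := exists_surgery_far hk hρ hω hX' hc₀ hch hnd hsub hhead hnear hfar hA' hC'
  exact Or.inl ⟨sx, planar k q, hsx.trans (sqBox_mono _ (by omega))⟩

end Gadget

end NTW17

end Literature.Probability.Percolation
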